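/-
Copyright: the b2b-balaban cell (near-miss cell 7), T⁴-continuum fan-out; row NE7b ROUND-2 swarm, seat
t4-ne7b-formalise-leaf-02 (gen 3) — support piece for the owner's NEW ROW S1c «order-free join clause» (R-OWNER-22-18,
journal l.10600: «every consumer proved for prefix contact transfers through ONE combinatorial lemma “connected ⇒ ∃
prefix-contact enumeration”»); offered to S1c's holder, not a claim of S1c.  Released under the licence of the
surrounding project.
-/
import Mathlib

/-!
# Connected touch graph ⇒ a contact index (row S1c support, Mathlib only)

Summits-side support leaf of the T⁴-continuum cell (rung (B)+1 on a FINITE torus only; NOT infinite volume, NOT the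
mass gap, NOT the Clay statement; NOT a proof of the spine estimate NE7b).  [folklore] elementary graph theory
(`SimpleGraph.dist`); nothing is quoted from print, nothing printed is asserted, no `[cite:]` tag, no `Prop`-valued
fact minted.

WHAT.  For parts `I`, a host `h` and a touch relation `touch : I → I → Prop` whose symmetrised graph
(`SimpleGraph.fromRel touch`) reaches every part from the host, **`exists_contactIndex`** gives an index `idx : I → ℕ`
with `idx h = 0` and, for every `i ≠ h`, a part `j` of STRICTLY SMALLER index touching `i` (`touch i j ∨ touch j i`) —
`idx` is the graph distance from the host and `j` the penultimate vertex of a shortest walk.  This is exactly the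
hypothesis shape of leaf-05 g2's `HistorySiblingSymmetry.forestAdm_of_chain` («touches SOME part of strictly smaller
index»), so an ORDER-FREE connected-touch-graph clause (R-OWNER-22-18) yields the forest∕prefix-contact form the
landed consumers were proved for; `exists_contactIndex_symm` is the version for a symmetric `touch`.

HONEST SCOPE.  A generic lemma; the re-read of `Realises`' consumers (row S1c proper) is its holder's.  NE7b NOT proved;
spine 0∕9.  HONEST DEPENDENCY (cell): continuum YM on T⁴ ⇐ BetaPertH ∧ nine spine estimates (0/9 proved); BetaPertH ⇐
(D1) ∧ (D4) ∧ CAP+tail; G-an2-4 gates asym, D1 and NE2/3/4.  This file changes none of it.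
-/

namespace Summit.QuantumFields.BalabanUV.T4Continuum.HistoryTouchIndex

variable {I : Type*}

/-- one step back along a walk to the host: a non-host start has a neighbour strictly closer to the host [folklore] -/
theorem exists_adj_dist_lt {G : SimpleGraph I} {h u : I} (q : G.Walk u h) (hu : u ≠ h) (hq : q.length = G.dist h u) :
    ∃ j, G.Adj u j ∧ G.dist h j < G.dist h u := by
  cases q with
  | nil => exact absurd rfl hu
  | cons hadj q' =>
      refine ⟨_, hadj, ?_⟩
      have h1 : G.dist h _ ≤ q'.reverse.length := SimpleGraph.dist_le q'.reverse
      rw [SimpleGraph.Walk.length_reverse] at h1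
      rw [SimpleGraph.Walk.length_cons] at hq
      omega

/-- **CONNECTED TOUCH GRAPH ⇒ CONTACT INDEX**: if the symmetrised touch graph reaches every part from the host `h`, the
graph distance from `h` is an index under which every non-host part touches a part of strictly smaller index.
[folklore] -/
theorem exists_contactIndex (touch : I → I → Prop) (h : I)
    (hconn : ∀ i, (SimpleGraph.fromRel touch).Reachable h i) :
    ∃ idx : I → ℕ, idx h = 0 ∧ ∀ i, i ≠ h → ∃ j, idx j < idx i ∧ (touch i j ∨ touch j i) := by
  refine ⟨fun i => (SimpleGraph.fromRel touch).dist h i, SimpleGraph.dist_self, fun i hi => ?_⟩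
  obtain ⟨p, hp⟩ := (hconn i).exists_walk_length_eq_dist
  have hrev : p.reverse.length = (SimpleGraph.fromRel touch).dist h i := by
    rw [SimpleGraph.Walk.length_reverse, hp]
  obtain ⟨j, hadj, hlt⟩ := exists_adj_dist_lt p.reverse hi hrev
  exact ⟨j, hlt, (SimpleGraph.fromRel_adj touch i j).1 hadj |>.2⟩

/-- the same for a SYMMETRIC touch relation: the smaller-index part `j` satisfies `touch i j` [folklore] -/
theorem exists_contactIndex_symm (touch : I → I → Prop) (hsymm : ∀ a b, touch a b → touch b a) (h : I)
    (hconn : ∀ i, (SimpleGraph.fromRel touch).Reachable h i) :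
    ∃ idx : I → ℕ, idx h = 0 ∧ ∀ i, i ≠ h → ∃ j, idx j < idx i ∧ touch i j := by
  obtain ⟨idx, h0, hidx⟩ := exists_contactIndex touch h hconn
  refine ⟨idx, h0, fun i hi => ?_⟩
  obtain ⟨j, hlt, ht⟩ := hidx i hi
  exact ⟨j, hlt, ht.elim id fun h' => hsymm _ _ h'⟩

/-- reachability from the host from CHAINED local touches: if every part is joined to the host by a list of parts each
touching the next (in either direction), the touch graph reaches it — a convenience form of the hypothesis. [folklore] -/
theorem reachable_of_relChain (touch : I → I → Prop) {h i : I}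
    (hc : Relation.ReflTransGen (fun a b => touch a b ∨ touch b a) h i) :
    (SimpleGraph.fromRel touch).Reachable h i := by
  induction hc with
  | refl => exact SimpleGraph.Reachable.refl _
  | @tail b c _ hbc ih =>
      by_cases heq : b = c
      · subst heq; exact ih
      · exact ih.trans (SimpleGraph.Adj.reachable ((SimpleGraph.fromRel_adj touch b c).2 ⟨heq, hbc⟩))

/-! ## Sanity (a path of three parts) -/

namespace Sanity

/-- on `Fin 3` with touches `0 → 1 → 2` (host `0`): part `2` does NOT touch the host, yet a contact index exists
(`idx = dist = (0, 1, 2)`; part `2` touches part `1` of smaller index) -/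
example : ∃ idx : Fin 3 → ℕ, idx 0 = 0 ∧ ∀ i, i ≠ 0 → ∃ j, idx j < idx i ∧ ((i : ℕ) + 1 = j ∨ (j : ℕ) + 1 = i) :=
  exists_contactIndex (fun a b : Fin 3 => (a : ℕ) + 1 = b) 0 fun i => reachable_of_relChain _ (by
    fin_cases i
    · exact Relation.ReflTransGen.refl
    · exact Relation.ReflTransGen.single (Or.inl (by decide))
    · exact (Relation.ReflTransGen.single (b := (1 : Fin 3)) (Or.inl (by decide))).tail (Or.inl (by decide)))

end Sanity

end Summit.QuantumFields.BalabanUV.T4Continuum.HistoryTouchIndex
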